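import Literature.MathematicalPhysics.QuantumFieldTheory.Balaban1983to89.B9GeoLemma21KLevelV1
import Literature.MathematicalPhysics.QuantumFieldTheory.Balaban1983to89.B9RWSumsReadsNbr

/-!
# `Balaban1983to89.B9GeoNbrCountKLevelV1` — the NEIGHBOURHOOD COUNT `#{y″ : d(y″, y) ≤ r} ≤ m_N` at the record geometry `geo9K i` ∕ `geo9Y x`,
# member-uniform above an `M`-threshold, FROM [4] Lemma 2.1 (2.61)

T. Bałaban, *Propagators and renormalization transformations for lattice gauge theories. II*, Commun. Math. Phys. **96** (1984) 223–250
[`Balaban1984PropagatorsII`, "[4]"], Lemma 2.1 (2.61) p. 234 (*"sup_{y∈𝔅} Σ_{y′∈𝔅} e^{−αδ₀d(y,y′)} ≤ c₁(α)"* for *"RM satisfying (2.59)"*), (2.46)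
p. 231 (the distance `d(y, y′)`); T. Bałaban, *Propagators for lattice gauge theories in a background field*, Commun. Math. Phys. **99** (1985)
389–434 [`Balaban1985BackgroundPropagators`, "B9"], p. 397 (*"Δ̃(y)"*: the blocks near `Δ(y)`), (3.43)–(3.46) p. 398.

statement-level skeleton of published theorems with citation tags; proofs where landed; nothing here is a claim about the
Yang–Mills mass gap

THE POINT.  The N06 knit's certificates of record (n06-d `Thm/BalabanUVNodesN06AtOpsYNuOfRecordV5ECoords`, n06-k `B9RWSumsCompleteGeo9YNbr`)
read the (3.43)–(3.46) co-readings on the metric neighbourhood `nbr (geo9Y x) 2 y = {y″ : d(y″, y) ≤ 2}` of radius 2 (n06-k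
`B9RWSumsReadsNbr.nbr`) and DISPLAY its cardinality as a binder `hnbr : ∀ x y, (nbr (geo9Y x) 2 y).card ≤ mN`.  This file supplies that
count from (2.61), which this lineage proved at the record geometry (`B9GeoLemma21KLevelV1.rowSum_geo9K_core`, κ := 1): every `y″` with
`d(y, y″) ≤ r` contributes at least `e^{−r}` to the row sum `Σ_{y′} e^{−d(y,y′)} ≤ c`, so `#nbr ≤ c·e^{r}`.
* §1 ★ `card_nbr_le_of_rowSum` — the generic step on any `B9.Geometry` with a symmetric distance: a row-sum bound at rate `κ ≥ 0` gives
  `(#nbr g r y : ℝ) ≤ c·e^{κr}`.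
* §2 ★ `exists_card_nbr_geo9K_le` — at the k-level V1 index: `∀ r, ∃ M_L mN, ∀ i, M_L ≤ M → ∀ y, #nbr (geo9K i) r y ≤ mN` (mN = ⌈c(1)e^{r}⌉₊).
* §3 ★ `exists_card_nbr_geo9Y_le` — at def-Y's members: `∀ r, ∃ M₀ mN : ℕ, ∀ M⋆ ≥ M₀, ∀ x : MemberY … M⋆, ∀ y, #nbr (geo9Y x) r y ≤ mN`
  (`M⋆ ≤ M` at a member, `B9PinMembersKLevelV1.mstar_le_M`), `exists_card_nbr_geo9Y_le_of_M` (the threshold on the member's own `M`),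
  ★ `exists_mN_hnbr_two` — the knit's binder shape LITERALLY (r = 2, the family `Fintype` instance the certificate binds), `exists_mN_hnbr` (any r).
* §4 the constants NAMED (the knit's E-letter pins must name `mN` in the STATEMENT, n06-d g5): ★ `nbrM₀Y … r`, ★ `nbrCountY … r` (the two
  witnesses, by `choose`), ★ `card_nbr_geo9Y_le_of_le`, ★★ `hnbr_two_of_le (hM : nbrM₀Y … 2 ≤ M⋆) : ∀ x y, (nbr (geo9Y x) 2 y).card ≤ nbrCountY … 2`
  — the certificate displays `hM₀` and DROPS `mN hnbr`; `hnbr_of_le` (any r).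

HONEST SCOPE.  A corollary of the tree's (2.61) with its GENERIC constant and its `M`-threshold (the (2.59) largeness *"RM sufficiently
large"*): the count is member-uniform (depends on `d, ℓ, b₀, b₁, r` only) but is asserted only above the threshold `M₀ ≤ M⋆`; the
threshold-free combinatorial count `mN(d, L)` (bounded degree of the touch graph of blocks × the fibres of `β`) is NOT claimed here.  Nothing
of [B9]'s estimates is asserted; count-neutral supply for the N06 knit (one displayed binder becomes an `M⋆`-threshold); N06 NOT discharged;
one finite lattice programme — nothing continuum, nothing about the mass gap.  Cell `pub-ymgap` (HUMAN RULING D-0062), Track A node N06 [B9],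
N06-ASSIGNMENT v1 bundle F4 (record-geometry binders, cf. `B9GeoLemma21KLevelV1` §4), seat `pub-ymgap-dag-n06-i` (gen 10), 2026-08-27.
-/

noncomputable section

namespace Literature.MathematicalPhysics.QuantumFieldTheory.Balaban1983to89.B9GeoNbrCountKLevelV1

open B6KLevelCensusIndexV1 (KIdx)
open B9GeoNormsKLevelV1 (geo9K)
open B9PinMembersKLevelV1 (MemberY geo9Y mstar_le_M)
open B9GeoLemma21KLevelV1 (rowSum_geo9K_core geo9K_dist_comm)
open B9RWSumsReadsNbr (nbr mem_nbr)

variable {d ℓ : ℕ} {hd : 1 ≤ d + 1} {hL : Odd (ℓ + 1) ∧ 1 < ℓ + 1} {b₀ b₁ : ℝ}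

/-! ## §1 The generic step: a row-sum bound counts the neighbourhood -/

section Generic

/-- ★ **A ROW SUM OF `e^{−κd}` COUNTS THE NEIGHBOURHOOD**: on any geometry with a symmetric distance, if `Σ_{y′} e^{−κd(y,y′)} ≤ c` with
`κ ≥ 0`, then `#{y″ : d(y″, y) ≤ r} ≤ c·e^{κr}` — each member of the neighbourhood contributes at least `e^{−κr}` to the row sum.
[cite: Balaban1984PropagatorsII, Lemma 2.1 (2.61) p.234; Balaban1985BackgroundPropagators, p.397 (Δ̃(y)), bookkeeping] -/
theorem card_nbr_le_of_rowSum {g : B9.Geometry} [Fintype g.Site] {κ c r : ℝ} (hκ : 0 ≤ κ)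
    (hsymm : ∀ a b : g.Site, g.dist a b = g.dist b a) {y : g.Site}
    (hrow : ∑ y' : g.Site, Real.exp (-(κ * g.dist y y')) ≤ c) :
    ((nbr g r y).card : ℝ) ≤ c * Real.exp (κ * r) := by
  classical
  -- each neighbour contributes at least `e^{−κr}`
  have hterm : ∀ y'' ∈ nbr g r y, Real.exp (-(κ * r)) ≤ Real.exp (-(κ * g.dist y y'')) := by
    intro y'' hy''
    have hd : g.dist y y'' ≤ r := by rw [hsymm]; exact mem_nbr.1 hy''
    exact Real.exp_le_exp.2 (neg_le_neg (mul_le_mul_of_nonneg_left hd hκ))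
  have h1 : ((nbr g r y).card : ℝ) * Real.exp (-(κ * r)) ≤ ∑ y'' ∈ nbr g r y, Real.exp (-(κ * g.dist y y'')) := by
    rw [← nsmul_eq_mul, ← Finset.sum_const]
    exact Finset.sum_le_sum hterm
  have h2 : ∑ y'' ∈ nbr g r y, Real.exp (-(κ * g.dist y y'')) ≤ ∑ y' : g.Site, Real.exp (-(κ * g.dist y y')) :=
    Finset.sum_le_sum_of_subset_of_nonneg (Finset.subset_univ _) fun _ _ _ => Real.exp_nonneg _
  have h3 : ((nbr g r y).card : ℝ) * Real.exp (-(κ * r)) ≤ c := h1.trans (h2.trans hrow)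
  calc ((nbr g r y).card : ℝ) = ((nbr g r y).card : ℝ) * Real.exp (-(κ * r)) * Real.exp (κ * r) := by
        rw [mul_assoc, ← Real.exp_add, neg_add_cancel, Real.exp_zero, mul_one]
    _ ≤ c * Real.exp (κ * r) := mul_le_mul_of_nonneg_right h3 (Real.exp_nonneg _)

/-- the count as a natural number: `#nbr ≤ ⌈c·e^{κr}⌉₊`. [cite: Balaban1984PropagatorsII, Lemma 2.1 (2.61) p.234, bookkeeping] -/
theorem card_nbr_le_ceil_of_rowSum {g : B9.Geometry} [Fintype g.Site] {κ c r : ℝ} (hκ : 0 ≤ κ)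
    (hsymm : ∀ a b : g.Site, g.dist a b = g.dist b a) {y : g.Site}
    (hrow : ∑ y' : g.Site, Real.exp (-(κ * g.dist y y')) ≤ c) :
    (nbr g r y).card ≤ ⌈c * Real.exp (κ * r)⌉₊ := by
  have h := (card_nbr_le_of_rowSum (r := r) hκ hsymm hrow).trans (Nat.le_ceil _)
  exact_mod_cast h

end Generic

/-! ## §2 At the k-level V1 index: the count above the (2.59) threshold, from (2.61) at rate 1 -/

section Index

/-- ★ **THE NEIGHBOURHOOD COUNT AT `geo9K`, ABOVE AN `M`-THRESHOLD**: for every radius `r` there are `M_L` and `mN` such that every k-level V1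
index with `M_L ≤ M` has `#{y″ : d(y″, y) ≤ r} ≤ mN` at every site `y` — (2.61) at rate κ = 1 (`rowSum_geo9K_core`) and the symmetry of (2.46)
(`geo9K_dist_comm`); `mN = ⌈c·e^{r}⌉₊` with (2.61)'s generic constant c. [cite: Balaban1984PropagatorsII, Lemma 2.1 (2.61) p.234 + (2.59) p.233, (2.46) p.231] -/
theorem exists_card_nbr_geo9K_le (r : ℝ) :
    ∃ ML : ℝ, ∃ mN : ℕ, ∀ (i : KIdx d ℓ hd hL b₀ b₁) [Fintype (geo9K i).Site], ML ≤ (geo9K i).M →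
      ∀ y : (geo9K i).Site, (nbr (geo9K i) r y).card ≤ mN := by
  obtain ⟨ML, C, h⟩ := rowSum_geo9K_core (d := d) (ℓ := ℓ) (hd := hd) (hL := hL) (b₀ := b₀) (b₁ := b₁) (κ := 1) one_pos
  refine ⟨ML, ⌈C * Real.exp (1 * r)⌉₊, fun i inst hM y => ?_⟩
  exact card_nbr_le_ceil_of_rowSum zero_le_one (geo9K_dist_comm i) (@h i inst hM y)

end Index

/-! ## §3 At def-Y's members `geo9Y x`: the knit's binder `hnbr` above an `M⋆`-threshold -/

section Members

/-- ★ **THE NEIGHBOURHOOD COUNT AT THE MEMBERS, UNIFORM ABOVE AN `M⋆`-THRESHOLD**: for every radius `r` there are `M₀, mN : ℕ` such that for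
every `M⋆ ≥ M₀`, every member `x : MemberY … M⋆` and every site `y`, `#{y″ : d(y″, y) ≤ r} ≤ mN` (a member has `M⋆ ≤ M = L·M_h`,
`mstar_le_M`). [cite: Balaban1984PropagatorsII, Lemma 2.1 (2.61) p.234 + (2.59) p.233; Balaban1985BackgroundPropagators, p.397 (Δ̃(y))] -/
theorem exists_card_nbr_geo9Y_le (r : ℝ) :
    ∃ M₀ mN : ℕ, ∀ (Mstar : ℕ), M₀ ≤ Mstar →
      ∀ (x : MemberY d ℓ hd hL b₀ b₁ Mstar) [Fintype (geo9Y x).Site] (y : (geo9Y x).Site), (nbr (geo9Y x) r y).card ≤ mN := by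
  obtain ⟨ML, mN, h⟩ := exists_card_nbr_geo9K_le (d := d) (ℓ := ℓ) (hd := hd) (hL := hL) (b₀ := b₀) (b₁ := b₁) r
  refine ⟨⌈ML⌉₊, mN, fun Mstar hM x inst y => @h x.toKIdx inst ?_ y⟩
  calc ML ≤ (⌈ML⌉₊ : ℝ) := Nat.le_ceil _
    _ ≤ (Mstar : ℝ) := by exact_mod_cast hM
    _ ≤ (geo9Y x).M := mstar_le_M x

/-- the same with the threshold read on the member's own `M = L·M_h` (the shape of the knit's other `M`-thresholds, e.g. `M39 ≤ (geo9Y x).M → …`):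
`∃ M_L mN, ∀ M⋆ x, M_L ≤ (geo9Y x).M → ∀ y, #nbr (geo9Y x) r y ≤ mN`. [cite: Balaban1984PropagatorsII, Lemma 2.1 (2.61) p.234 + (2.59) p.233, bookkeeping] -/
theorem exists_card_nbr_geo9Y_le_of_M (r : ℝ) :
    ∃ ML : ℝ, ∃ mN : ℕ, ∀ (Mstar : ℕ) (x : MemberY d ℓ hd hL b₀ b₁ Mstar) [Fintype (geo9Y x).Site], ML ≤ (geo9Y x).M →
      ∀ y : (geo9Y x).Site, (nbr (geo9Y x) r y).card ≤ mN := by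
  obtain ⟨ML, mN, h⟩ := exists_card_nbr_geo9K_le (d := d) (ℓ := ℓ) (hd := hd) (hL := hL) (b₀ := b₀) (b₁ := b₁) r
  exact ⟨ML, mN, fun _ x inst hM y => @h x.toKIdx inst hM y⟩

/-- ★ **THE KNIT'S BINDER `hnbr`, LITERALLY** (radius 2, the family `Fintype` instance the certificate binds): there are `M₀, mN : ℕ` with
`∀ M⋆ ≥ M₀, ∀ x y, (nbr (geo9Y x) 2 y).card ≤ mN` — consume by `obtain ⟨M₀, mN, h⟩ := exists_mN_hnbr_two` and `hnbr := h M⋆ hM₀`.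
[cite: Balaban1984PropagatorsII, Lemma 2.1 (2.61) p.234 + (2.59) p.233; Balaban1985BackgroundPropagators, (3.43)–(3.46) p.398 + p.397 (Δ̃(y))] -/
theorem exists_mN_hnbr_two :
    ∃ M₀ mN : ℕ, ∀ (Mstar : ℕ), M₀ ≤ Mstar →
      ∀ [∀ x : MemberY d ℓ hd hL b₀ b₁ Mstar, Fintype (geo9Y x).Site],
        ∀ (x : MemberY d ℓ hd hL b₀ b₁ Mstar) (y : (geo9Y x).Site), (nbr (geo9Y x) 2 y).card ≤ mN := by
  obtain ⟨M₀, mN, h⟩ := exists_card_nbr_geo9Y_le (d := d) (ℓ := ℓ) (hd := hd) (hL := hL) (b₀ := b₀) (b₁ := b₁) 2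
  exact ⟨M₀, mN, fun Mstar hM instY x y => @h Mstar hM x (instY x) y⟩

/-- the same at any radius `r` in the family-instance shape. [cite: Balaban1984PropagatorsII, Lemma 2.1 (2.61) p.234 + (2.59) p.233, bookkeeping] -/
theorem exists_mN_hnbr (r : ℝ) :
    ∃ M₀ mN : ℕ, ∀ (Mstar : ℕ), M₀ ≤ Mstar →
      ∀ [∀ x : MemberY d ℓ hd hL b₀ b₁ Mstar, Fintype (geo9Y x).Site],
        ∀ (x : MemberY d ℓ hd hL b₀ b₁ Mstar) (y : (geo9Y x).Site), (nbr (geo9Y x) r y).card ≤ mN := by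
  obtain ⟨M₀, mN, h⟩ := exists_card_nbr_geo9Y_le (d := d) (ℓ := ℓ) (hd := hd) (hL := hL) (b₀ := b₀) (b₁ := b₁) r
  exact ⟨M₀, mN, fun Mstar hM instY x y => @h Mstar hM x (instY x) y⟩

end Members

/-! ## §4 Named constants (the knit's request: `mN` must be NAMED in the certificate's E-letter pins, so `∃` will not do) -/

section Named

variable (d ℓ : ℕ) (hd : 1 ≤ d + 1) (hL : Odd (ℓ + 1) ∧ 1 < ℓ + 1) (b₀ b₁ : ℝ)

/-- ★ **THE `M⋆`-THRESHOLD OF THE NEIGHBOURHOOD COUNT AT RADIUS `r`, NAMED**: `nbrM₀Y d ℓ hd hL b₀ b₁ r : ℕ` (the first witness of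
`exists_card_nbr_geo9Y_le r`, by `choose` — opaque; a function of `d, ℓ, b₀, b₁, r` only). [cite: Balaban1984PropagatorsII, (2.59) p.233 («RM sufficiently large»), bookkeeping] -/
def nbrM₀Y (r : ℝ) : ℕ :=
  (exists_card_nbr_geo9Y_le (d := d) (ℓ := ℓ) (hd := hd) (hL := hL) (b₀ := b₀) (b₁ := b₁) r).choose

/-- ★ **THE NEIGHBOURHOOD COUNT AT RADIUS `r`, NAMED**: `nbrCountY d ℓ hd hL b₀ b₁ r : ℕ` — a member-uniform bound on `#{y″ : d(y″, y) ≤ r}`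
above the threshold `nbrM₀Y … r ≤ M⋆` (chosen from `exists_card_nbr_geo9Y_le r`, whose proof builds `⌈c(1)·e^{r}⌉₊` from (2.61)'s generic
constant; as a `choose` term its value is opaque — only `card_nbr_geo9Y_le_of_le` is to be used).
[cite: Balaban1984PropagatorsII, Lemma 2.1 (2.61) p.234; Balaban1985BackgroundPropagators, p.397 (Δ̃(y)), bookkeeping] -/
def nbrCountY (r : ℝ) : ℕ :=
  (exists_card_nbr_geo9Y_le (d := d) (ℓ := ℓ) (hd := hd) (hL := hL) (b₀ := b₀) (b₁ := b₁) r).choose_spec.choose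

variable {d ℓ hd hL b₀ b₁}

/-- ★ **THE COUNT WITH THE NAMED CONSTANTS**: `nbrM₀Y … r ≤ M⋆ ⇒ ∀ x y, #nbr (geo9Y x) r y ≤ nbrCountY … r` (any `Fintype` instance on the sites).
[cite: Balaban1984PropagatorsII, Lemma 2.1 (2.61) p.234 + (2.59) p.233] -/
theorem card_nbr_geo9Y_le_of_le {r : ℝ} {Mstar : ℕ} (hM : nbrM₀Y d ℓ hd hL b₀ b₁ r ≤ Mstar)
    (x : MemberY d ℓ hd hL b₀ b₁ Mstar) [Fintype (geo9Y x).Site] (y : (geo9Y x).Site) :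
    (nbr (geo9Y x) r y).card ≤ nbrCountY d ℓ hd hL b₀ b₁ r :=
  (exists_card_nbr_geo9Y_le (d := d) (ℓ := ℓ) (hd := hd) (hL := hL) (b₀ := b₀) (b₁ := b₁) r).choose_spec.choose_spec Mstar hM x y

/-- ★★ **THE KNIT'S BINDER `hnbr` FROM ONE DISPLAYED THRESHOLD** (radius 2, the family `Fintype` instance the certificate binds): display
`hM₀ : nbrM₀Y d ℓ hd hL b₀ b₁ 2 ≤ M⋆`, pin `mN := nbrCountY d ℓ hd hL b₀ b₁ 2` in the E-letters, and take `hnbr := hnbr_two_of_le hM₀`.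
[cite: Balaban1984PropagatorsII, Lemma 2.1 (2.61) p.234 + (2.59) p.233; Balaban1985BackgroundPropagators, (3.43)–(3.46) p.398 + p.397 (Δ̃(y))] -/
theorem hnbr_two_of_le {Mstar : ℕ} (hM : nbrM₀Y d ℓ hd hL b₀ b₁ 2 ≤ Mstar)
    [∀ x : MemberY d ℓ hd hL b₀ b₁ Mstar, Fintype (geo9Y x).Site] :
    ∀ (x : MemberY d ℓ hd hL b₀ b₁ Mstar) (y : (geo9Y x).Site), (nbr (geo9Y x) 2 y).card ≤ nbrCountY d ℓ hd hL b₀ b₁ 2 :=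
  fun x y => card_nbr_geo9Y_le_of_le hM x y

/-- the same at any radius `r` in the family-instance shape. [cite: Balaban1984PropagatorsII, Lemma 2.1 (2.61) p.234 + (2.59) p.233, bookkeeping] -/
theorem hnbr_of_le {r : ℝ} {Mstar : ℕ} (hM : nbrM₀Y d ℓ hd hL b₀ b₁ r ≤ Mstar)
    [∀ x : MemberY d ℓ hd hL b₀ b₁ Mstar, Fintype (geo9Y x).Site] :
    ∀ (x : MemberY d ℓ hd hL b₀ b₁ Mstar) (y : (geo9Y x).Site), (nbr (geo9Y x) r y).card ≤ nbrCountY d ℓ hd hL b₀ b₁ r :=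
  fun x y => card_nbr_geo9Y_le_of_le hM x y

end Named

end Literature.MathematicalPhysics.QuantumFieldTheory.Balaban1983to89.B9GeoNbrCountKLevelV1
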